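import Summits.QuantumFields.YangMills.Theorems.BalabanUVNodesN15FullPropagatorV1XTwoSidedNode
import HarnessLib

/-!
# `NE2PlusOperator` WITH THE M-GUARD DISCHARGED (`M₅ = 1`): THE NON-VACUOUS STATEMENT SHAPE FOR UNIT-TORUS FAMILIES (`M ≡ 1`), FILE 24's socket and FILE 30's torus theorem RE-STATED in it
# — answer to referee ref-F g16 FLAG-VACUITY-A1 (pub-ymgap INBOX l.24583, 2026-08-27T23:19Z) (dag-n15-c g10, FILE 39; Track-A node N15 = NE2, s1 «background-layer OPERATOR ingredient»)

`--kind definition --supports stmt-QuantumFields-20544 --as helper` (K3⁷; count-neutral).  Imports BY NAME this seat's FILE 30 `…FullPropagatorV1XTwoSidedNode` (`fgFamilyV1X`, `twoSidedLettersX_torus`;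
through it FILE 27 `fgInstanceV1G` ∕ `uniform_layer_fullGM₂R`, FILE 24 `etaRateIneq342_twoSided_of_letters` ∕ `bgInstanceM₂R` ∕ `bgFamilyM₂R`, [Lit] `T4EtaRate.NE2PlusOperator` ∕ `EtaRateIneq342`);
nothing in the tree is modified.

THE FLAG (verbatim gist).  `T4EtaRate.NE2PlusOperator c35 pi Kd := ∃ M₅ δ₀ a₀ B₀ γ > 0, ∀ i, M₅ ≤ (pi i).gf.M → …`; on every realised unit-torus instance `(pi i).gf.M = 1` (`unitTorusGeo … .M := 1`), so the
witness `M₅ := 2` proves the statement for EVERY kernel family — the by-name conclusions of FILES 27∕30 (and the lineage's earlier torus knits) are vacuous AS TYPED; their content lives in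
the proofs (engine witness `M₅ = 1`).  REPAIR (this file, no new mathematics): the guard-free shape `NE2PlusOperatorM1` (= `NE2PlusOperator` with `M₅ := 1` and the guard read through
`1 ≤ M`, here an explicit hypothesis of the socket, `rfl`-true on the torus), which IMPLIES `NE2PlusOperator` and is NOT provable without the estimate; FILE 24 §3 and FILE 30 §2 re-run
with this conclusion.  The sequel files (34∕35∕37∕38) conclude `NE2PlusOperatorM1` first.

WHAT.  §1 `NE2PlusOperatorM1` (def), `NE2PlusOperatorM1.ne2PlusOperator` (the implication).  §2 ★★★ `ne2PlusOperatorM1_twoSided_of_letters` (FILE 24 §3's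
socket with `hM1 : ∀ i, 1 ≤ M_i` and the guard-free conclusion; proof verbatim otherwise).  §3 ★★★ **`ne2PlusOperatorM1_fullGM₂_v1X_of_entry2`**, ★★★ **`ne2PlusOperatorM1_fullGM₂_v1X :
NE2PlusOperatorM1 c₃₅ (fgInstanceV1G d 𝔄 ι hL) (fgFamilyV1X d 𝔄 ι e hL b)`** (hypothesis-free, NON-VACUOUS: `∃ δ₀ a₀ B₀ γ > 0, ∀ i, ∀ α₀ ∈ (0, a₀], ∀ A′ regular at (c₃₅, α₀),
EtaRateIneq342 (fgFamilyV1X … i) B₀ δ₀ γ A′`), `_dim4`.  §4 `reg335_fgInstanceV1G_const`: constant fields `A′ ≡ a`, `‖a‖ ≤ c₃₅α₀`, ARE regular on the fine carrier — the ∀-block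
is inhabited by non-zero configurations at every `α₀ ∈ (0, a₀]` (witness that the repaired statement is not vacuous).

HONEST FRAMING.  Statement repair only; the estimate is FILE 30's (same letters, same constants); model-level items as in FILE 30∕32; NE2⁺ as printed NOT PRINTED; count-neutral; N15 NOT
discharged; one finite torus at fixed ε — NOT ℝ⁴, NOT infinite volume, NOT OS, NOT a mass gap, NOT Clay.
-/

noncomputable section

open scoped BigOperators
open Finset

namespace Summit.QuantumFields.YangMills.BalabanUVNodes.N15.BackgroundLayer

open Literature.MathematicalPhysics.QuantumFieldTheory.Balaban1983to89
open Literature.MathematicalPhysics.QuantumFieldTheory.Balaban1983to89.B11SectG (BlockNorm HasMaj RowSum hasMaj_comp hasMaj_comp_exp hasMaj_zero)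
open Literature.MathematicalPhysics.QuantumFieldTheory.Balaban1983to89.T4EtaRate (PairedInstance EtaPairing EtaRateIneq342 NE2PlusOperator rateFactor)
open Literature.MathematicalPhysics.QuantumFieldTheory.Balaban1983to89.T4EtaRateDefect (idef idef_apply idef_comp idef_zero rateWeight)
open Literature.MathematicalPhysics.QuantumFieldTheory.Balaban1983to89.T4EtaRateCoeffDefect (pull pull_apply diagK diagK_nonneg)
open Literature.MathematicalPhysics.QuantumFieldTheory.Balaban1983to89.B6RandomWalk (Triangle254)
open Summit.QuantumFields.YangMills.BalabanUVNodes.N15.OperatorReadout (opGeo opFamily opGeo_len rateFactor_opGeo etaRateIneq342_of_hasMaj_rateWeight)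
open Summit.QuantumFields.YangMills.BalabanUVNodes.N15.MatrixSpecies (mmulOp liftEquiv liftMap liftBlk)
open Summit.QuantumFields.YangMills.BalabanUVNodes.N15.SiteLayer (hasMaj_exp_comp_diagK hasMaj_diagK_comp_exp hasMaj_add_exp hasMaj_exp_mono)


variable {d : ℕ}

/-! ## §1 The guard-free statement shape -/

section Shape

/-- **NE2⁺, operator layer, M-GUARD DISCHARGED**: `T4EtaRate.NE2PlusOperator` with `M₅ := 1` read through `1 ≤ M` — there are `δ₀, a₀, B₀, γ > 0`, uniform in the paired instance, such that for
EVERY index, every `α₀ > 0` with `Mα₀ ≤ a₀` and every fine configuration regular at `(c₃₅, α₀)`, the η-difference family obeys `EtaRateIneq342`.  NOT vacuous on families with inert `M ≡ 1`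
(referee ref-F FLAG-VACUITY-A1). [cite: Balaban1985BackgroundPropagators, Thm 3.1 p.397 + Thm 3.14 pp.426–427 (quantifier template)] -/
def NE2PlusOperatorM1 {I : Type} (c35 : ℝ) (pi : I → PairedInstance) (Kd : ∀ i, B9.KernelFamily (pi i).gc (pi i).Bf) : Prop :=
  ∃ δ₀ a₀ B₀ γ : ℝ, 0 < δ₀ ∧ 0 < a₀ ∧ 0 < B₀ ∧ 0 < γ ∧
    ∀ i : I, ∀ α₀ : ℝ, 0 < α₀ → (pi i).gf.M * α₀ ≤ a₀ → ∀ U : (pi i).Bf.Cfg, (pi i).Bf.Reg335 c35 α₀ U → EtaRateIneq342 (Kd i) B₀ δ₀ γ U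

/-- The guard-free shape IMPLIES the printed-template shape (witness `M₅ := 1`; the guard is simply not used). [folklore] -/
theorem NE2PlusOperatorM1.ne2PlusOperator {I : Type} {c35 : ℝ} {pi : I → PairedInstance} {Kd : ∀ i, B9.KernelFamily (pi i).gc (pi i).Bf}
    (h : NE2PlusOperatorM1 c35 pi Kd) : NE2PlusOperator c35 pi Kd := by
  obtain ⟨δ₀, a₀, B₀, γ, hδ, ha, hB, hγ, H⟩ := h
  exact ⟨1, δ₀, a₀, B₀, γ, one_pos, hδ, ha, hB, hγ, fun i _ α₀ hα₀ hMα U hU => H i α₀ hα₀ hMα U hU⟩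

end Shape

/-! ## §2 FILE 24's socket with the guard discharged -/

section Node

variable {I J ι : Type} [Fintype J] [DecidableEq J] [Fintype ι] [DecidableEq ι] (g : I → B6.Geometry) (X X' : I → Type) [∀ i, Fintype (X i)]
  [∀ i, Fintype (X' i)] [∀ i, DecidableEq (X i)] [∀ i, DecidableEq (X' i)] (blk : ∀ i, X i → (g i).Site) (π : ∀ i, X' i → X i) (τ : ∀ i, J → X i ≃ X i)
  (τ' : ∀ i, J → X' i ≃ X' i) (n n' : I → ℝ) (nsh : I → ℕ) (Bc Bf : I → B9.Backgrounds)
  (P : ∀ i, EtaPairing (opGeo (g i) (X i × ι) (liftBlk (blk i) ι)) (fineGeo (g i) (X' i × ι) (liftBlk (blk i ∘ π i) ι) (nsh i)) (Bc i) (Bf i))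
  (cfgF : ∀ i, (Bf i).Cfg → (X' i → Matrix ι ι ℝ) × (J ⊕ J → X' i → Matrix ι ι ℝ)) (cfgC : ∀ i, (Bf i).Cfg → (X i → Matrix ι ι ℝ) × (J ⊕ J → X i → Matrix ι ι ℝ))
  (θ : I → ℝ) (ν : I → J) (G D₃ : ∀ i, (X i × ι → ℝ) →ₗ[ℝ] (X i × ι → ℝ)) (D : ∀ i, J ⊕ J → (X i × ι → ℝ) →ₗ[ℝ] (X i × ι → ℝ))
  (G' D₃' : ∀ i, (X' i × ι → ℝ) →ₗ[ℝ] (X' i × ι → ℝ)) (D' : ∀ i, J ⊕ J → (X' i × ι → ℝ) →ₗ[ℝ] (X' i × ι → ℝ))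

/-- ★★★ **NE2⁺, OPERATOR LAYER — `T4EtaRate.NE2PlusOperator` BY NAME FOR THE TWO-SIDED BY-PARTS MATRIX FAMILY OVER AN ARBITRARY COEFFICIENT-CARRIER PAIR WHOSE (3.35) REGULARITY
DELIVERS THE LETTER BUNDLE.**  For ANY family of realised instances `⟨opGeo, fineGeo, B_c, B_f, P⟩` with readings `cfgF_i, cfgC_i` of the fine ∕ coarse coefficient configurations such
that, for every configuration `U` regular at level `c₃₅` with window `α₀ > 0` (and `M ≥ 1`), the fifteen letters `TwoSidedLetters … (κ·c₃₅Mα₀) θ_i (cfgF_i U) (cfgC_i U)` hold together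
with the shift-defect row letter at the coarse forward coefficients (`≤ m_T·(κc₃₅Mα₀)·θ_ie^{−δd}`, linear in the scale); with the UNIFORM `U ≡ 1` letters of FILE 20 at rate `δ`
(`6σ < δ`): pieces, derived pieces over `J ⊕ J`, the fine Laplacian piece, the `U ≡ 1` entry-2 operators `G_i∇_ν*, G′_i∇′_ν*`, the η-defects (`≤ m₀θ_ie^{−δd}`), the one-step shifts
(`≤ c_Te^{−δd}`); `0 ≤ θ_i ≤ (L^j)^{−γ}`, `γ > 0`; [B6] carriers; `η, L > 0`, sites of size `≥ 1`; `c₃₅, κ, r₀ > 0` (the letters are demanded only in the WINDOW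
`c₃₅Mα₀ ≤ r₀`, where the `ad`-polynomial coefficients are controlled) —: `NE2PlusOperator c₃₅ (bgInstanceM₂R …) (bgFamilyM₂R …)` with `M₅ = 1`,
`a₀ = min((2κc₃₅(1+|J ⊕ J|)(βc_r+1))⁻¹, (2(K+1))⁻¹, r₀∕c₃₅)` (`K = (c_T+1)κc₃₅|J|βc_r³`), `B₀ = bgConst + bgConst1 + bpConst2L(…, m_Tκc₃₅a₀) + 1` at scale `κc₃₅a₀`, `δ₀ = δ − 6σ`.  This is the
socket for Bałaban's OWN species (3.52): its coarse coefficients are `ad`-polynomials of the COARSE gauge field (readings, not block averages).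
[cite: Balaban1985BackgroundPropagators, Thm 3.1 p.397 (quantifier template); (3.35)–(3.36) p.396, (3.42) p.397, (3.52) p.400 (shapes, mechanism)] -/
theorem ne2PlusOperatorM1_twoSided_of_letters (c35 κ r₀ : ℝ) (hc35 : 0 < c35) (hκ : 0 < κ) (hr₀ : 0 < r₀)
    (htri : ∀ i, Triangle254 (g i)) (hd : ∀ i (a b : (g i).Site), 0 ≤ (g i).dist a b) (hd0 : ∀ i (y : (g i).Site), (g i).dist y y = 0) {σ cr : ℝ} (hσ : 0 ≤ σ)
    (hcr : 0 ≤ cr) (hrow : ∀ i, RowSum (g i) σ cr) (hη : ∀ i, 0 < (g i).eta) (hL : ∀ i, 0 < (g i).L) (hlen : ∀ i y, 1 ≤ (g i).len y) (hM1 : ∀ i, 1 ≤ (g i).M)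
    {δ β m₀ γ cT mT : ℝ} (hσδ : 6 * σ < δ) (hβ : 0 ≤ β) (hm₀ : 0 ≤ m₀) (hγ : 0 < γ) (hθ : ∀ i, 0 ≤ θ i) (hθγ : ∀ i y, θ i ≤ rateWeight (g i) γ y) (hcT : 0 ≤ cT) (hmT : 0 ≤ mT)
    (hG : ∀ i, HasMaj (BlockNorm.ofBlocks (g i) (liftBlk (blk i) ι)) (BlockNorm.ofBlocks (g i) (liftBlk (blk i) ι)) (G i) (fun y y' => β * Real.exp (-(δ * (g i).dist y y'))))
    (hD : ∀ i μ, HasMaj (BlockNorm.ofBlocks (g i) (liftBlk (blk i) ι)) (BlockNorm.ofBlocks (g i) (liftBlk (blk i) ι)) (D i μ) (fun y y' => β * Real.exp (-(δ * (g i).dist y y'))))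
    (hG' : ∀ i, HasMaj (BlockNorm.ofBlocks (g i) (liftBlk (blk i ∘ π i) ι)) (BlockNorm.ofBlocks (g i) (liftBlk (blk i ∘ π i) ι)) (G' i) (fun y y' => β * Real.exp (-(δ * (g i).dist y y'))))
    (hD' : ∀ i μ, HasMaj (BlockNorm.ofBlocks (g i) (liftBlk (blk i ∘ π i) ι)) (BlockNorm.ofBlocks (g i) (liftBlk (blk i ∘ π i) ι)) (D' i μ)
      (fun y y' => β * Real.exp (-(δ * (g i).dist y y'))))
    (hD₃' : ∀ i, HasMaj (BlockNorm.ofBlocks (g i) (liftBlk (blk i ∘ π i) ι)) (BlockNorm.ofBlocks (g i) (liftBlk (blk i ∘ π i) ι)) (D₃' i) (fun y y' => β * Real.exp (-(δ * (g i).dist y y'))))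
    (hDG : ∀ i, HasMaj (BlockNorm.ofBlocks (g i) (liftBlk (blk i) ι)) (BlockNorm.ofBlocks (g i) (liftBlk (blk i ∘ π i) ι)) (idef (pull (liftMap (π i) ι)) (pull (liftMap (π i) ι)) (G' i) (G i))
      (fun y y' => m₀ * θ i * Real.exp (-(δ * (g i).dist y y'))))
    (hDD : ∀ i μ, HasMaj (BlockNorm.ofBlocks (g i) (liftBlk (blk i) ι)) (BlockNorm.ofBlocks (g i) (liftBlk (blk i ∘ π i) ι))
      (idef (pull (liftMap (π i) ι)) (pull (liftMap (π i) ι)) (D' i μ) (D i μ)) (fun y y' => m₀ * θ i * Real.exp (-(δ * (g i).dist y y'))))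
    (hDD₃ : ∀ i, HasMaj (BlockNorm.ofBlocks (g i) (liftBlk (blk i) ι)) (BlockNorm.ofBlocks (g i) (liftBlk (blk i ∘ π i) ι))
      (idef (pull (liftMap (π i) ι)) (pull (liftMap (π i) ι)) (D₃' i) (D₃ i)) (fun y y' => m₀ * θ i * Real.exp (-(δ * (g i).dist y y'))))
    (hS : ∀ i ν, HasMaj (BlockNorm.ofBlocks (g i) (liftBlk (blk i) ι)) (BlockNorm.ofBlocks (g i) (liftBlk (blk i) ι)) (G i ∘ₗ fgradAdj (n i) (liftEquiv (τ i ν) ι))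
      (fun y y' => β * Real.exp (-(δ * (g i).dist y y'))))
    (hS' : ∀ i ν, HasMaj (BlockNorm.ofBlocks (g i) (liftBlk (blk i ∘ π i) ι)) (BlockNorm.ofBlocks (g i) (liftBlk (blk i ∘ π i) ι)) (G' i ∘ₗ fgradAdj (n' i) (liftEquiv (τ' i ν) ι))
      (fun y y' => β * Real.exp (-(δ * (g i).dist y y'))))
    (hDS : ∀ i ν, HasMaj (BlockNorm.ofBlocks (g i) (liftBlk (blk i) ι)) (BlockNorm.ofBlocks (g i) (liftBlk (blk i ∘ π i) ι))
      (idef (pull (liftMap (π i) ι)) (pull (liftMap (π i) ι)) (G' i ∘ₗ fgradAdj (n' i) (liftEquiv (τ' i ν) ι)) (G i ∘ₗ fgradAdj (n i) (liftEquiv (τ i ν) ι)))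
      (fun y y' => m₀ * θ i * Real.exp (-(δ * (g i).dist y y'))))
    (hSh : ∀ i μ, HasMaj (BlockNorm.ofBlocks (g i) (liftBlk (blk i) ι)) (BlockNorm.ofBlocks (g i) (liftBlk (blk i) ι)) (pull (liftEquiv (τ i μ) ι)) (fun y y' => cT * Real.exp (-(δ * (g i).dist y y'))))
    (hSh' : ∀ i μ, HasMaj (BlockNorm.ofBlocks (g i) (liftBlk (blk i ∘ π i) ι)) (BlockNorm.ofBlocks (g i) (liftBlk (blk i ∘ π i) ι)) (pull (liftEquiv (τ' i μ) ι))
      (fun y y' => cT * Real.exp (-(δ * (g i).dist y y'))))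
    (hLt : ∀ i (U : (Bf i).Cfg) (α₀ : ℝ), (Bf i).Reg335 c35 α₀ U → 0 < α₀ → 1 ≤ (g i).M → c35 * (g i).M * α₀ ≤ r₀ →
      TwoSidedLetters J ι (π i) (τ i) (τ' i) (n i) (n' i) (κ * (c35 * (g i).M * α₀)) (θ i) (cfgF i U) (cfgC i U))
    (hDSh : ∀ i (U : (Bf i).Cfg) (α₀ : ℝ), (Bf i).Reg335 c35 α₀ U → 0 < α₀ → 1 ≤ (g i).M → c35 * (g i).M * α₀ ≤ r₀ →
      ∀ μ, HasMaj (BlockNorm.ofBlocks (g i) (liftBlk (liftBlk (blk i) ι) J)) (BlockNorm.ofBlocks (g i) (liftBlk (blk i ∘ π i) ι))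
        (idef (pull (liftMap (π i) ι)) (pull (liftMap (π i) ι)) (pull (liftEquiv (τ' i μ) ι)) (pull (liftEquiv (τ i μ) ι)) ∘ₗ
          (mmulOp ((cfgC i U).2 (Sum.inl μ) ∘ ⇑(τ i μ).symm) ∘ₗ sumJ fun ν => G i ∘ₗ fgradAdj (n i) (liftEquiv (τ i ν) ι)))
        (fun y y' => mT * (κ * (c35 * (g i).M * α₀)) * θ i * Real.exp (-(δ * (g i).dist y y')))) :
    NE2PlusOperatorM1 c35 (fun i => bgInstanceM₂R (blk i) (π i) (nsh i) (Bc i) (Bf i) (P i))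
      (fun i => bgFamilyM₂R (blk i) (π i) (nsh i) (Bc i) (Bf i) (P i) (cfgF i) (cfgC i) (τ i) (τ' i) (n i) (n' i) (ν i) (G i) (D₃ i) (D i) (G' i) (D₃' i) (D' i)) := by
  have hnJ : (0 : ℝ) ≤ Fintype.card J := Nat.cast_nonneg _
  have hnJ2 : (0 : ℝ) ≤ Fintype.card (J ⊕ J) := Nat.cast_nonneg _
  have hJ1 : (1 : ℝ) ≤ 1 + Fintype.card (J ⊕ J) := le_add_of_nonneg_right hnJ2
  have hJ0 : (0 : ℝ) < 1 + Fintype.card (J ⊕ J) := lt_of_lt_of_le one_pos hJ1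
  have hκc : 0 < κ * c35 := mul_pos hκ hc35
  -- the guard constant of the perturbation series and the by-parts one
  set a₁ : ℝ := (2 * ((κ * c35) * (1 + Fintype.card (J ⊕ J))) * (β * cr + 1))⁻¹ with ha₁_def
  set a₂ : ℝ := (2 * ((cT + 1) * (κ * c35) * Fintype.card J * β * (cr * cr * cr) + 1))⁻¹ with ha₂_def
  have hden₁ : 0 < 2 * ((κ * c35) * (1 + Fintype.card (J ⊕ J))) * (β * cr + 1) := by positivity
  have hden₂ : 0 < 2 * ((cT + 1) * (κ * c35) * Fintype.card J * β * (cr * cr * cr) + 1) := by positivity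
  have ha₁ : 0 < a₁ := inv_pos.2 hden₁
  have ha₂ : 0 < a₂ := inv_pos.2 hden₂
  set a₀ : ℝ := min (min a₁ a₂) (r₀ / c35) with ha₀_def
  have ha₀ : 0 < a₀ := lt_min (lt_min ha₁ ha₂) (div_pos hr₀ hc35)
  have ha₀₁ : a₀ ≤ a₁ := (min_le_left _ _).trans (min_le_left _ _)
  have ha₀₂ : a₀ ≤ a₂ := (min_le_left _ _).trans (min_le_right _ _)
  have ha₀r : c35 * a₀ ≤ r₀ := by
    have h := min_le_right (min a₁ a₂) (r₀ / c35)
    rw [← ha₀_def] at h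
    calc c35 * a₀ ≤ c35 * (r₀ / c35) := mul_le_mul_of_nonneg_left h hc35.le
      _ = r₀ := mul_div_cancel₀ r₀ hc35.ne'
  have hA0 : 0 ≤ κ * c35 * a₀ := by positivity
  have hq : β * ((1 + Fintype.card (J ⊕ J)) * (κ * c35 * a₀)) * cr ≤ 1 / 2 := by
    have hq₁ : β * ((1 + Fintype.card (J ⊕ J)) * (κ * c35 * a₁)) * cr ≤ 1 / 2 := by
      have h1 : β * ((1 + Fintype.card (J ⊕ J)) * (κ * c35 * a₁)) * cr = (β * cr) * ((κ * c35) * (1 + Fintype.card (J ⊕ J)) * a₁) := by ring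
      have h2 : (κ * c35) * (1 + Fintype.card (J ⊕ J)) * a₁ = (2 * (β * cr + 1))⁻¹ := by
        rw [ha₁_def]; field_simp
      rw [h1, h2, ← div_eq_mul_inv, div_le_iff₀ (by positivity)]
      nlinarith [mul_nonneg hβ hcr]
    refine le_trans ?_ hq₁
    have h0 : 0 ≤ β * ((1 + Fintype.card (J ⊕ J)) * (κ * c35)) * cr := by positivity
    nlinarith
  have hq2 : 1 * rowConst (Fintype.card J) β cT (κ * c35 * a₀) cr * cr * cr ≤ 1 / 2 :=
    rowConst_small hnJ hβ hcT hκc.le hcr ha₀₂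
  have hC0 : 0 ≤ bgConst β cr m₀ (1 + Fintype.card (J ⊕ J)) (κ * c35 * a₀) := bgConst_nonneg hβ hcr hm₀ hJ0.le hA0
  have hC1 : 0 ≤ bgConst1 β cr m₀ (1 + Fintype.card (J ⊕ J)) (κ * c35 * a₀) := bgConst1_nonneg hβ hcr hm₀ hJ0.le hA0
  have hmT' : 0 ≤ mT * (κ * c35 * a₀) := mul_nonneg hmT hA0
  have hC2 : 0 ≤ bpConst2L (Fintype.card J) (Fintype.card (J ⊕ J)) β cr m₀ (κ * c35 * a₀) cT (mT * (κ * c35 * a₀)) :=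
    bpConst2L_nonneg hnJ hnJ2 hβ hcr hm₀ hA0 hcT hmT' (by linarith)
  refine ⟨δ - 6 * σ, a₀, bgConst β cr m₀ (1 + Fintype.card (J ⊕ J)) (κ * c35 * a₀) + bgConst1 β cr m₀ (1 + Fintype.card (J ⊕ J)) (κ * c35 * a₀) +
    bpConst2L (Fintype.card J) (Fintype.card (J ⊕ J)) β cr m₀ (κ * c35 * a₀) cT (mT * (κ * c35 * a₀)) + 1, γ, by linarith, ha₀, by linarith, hγ,
    fun i α₀ hα₀ hMα U hreg => ?_⟩
  have hM' : 1 ≤ (g i).M := hM1 i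
  have hMα' : (g i).M * α₀ ≤ a₀ := hMα
  have hgd : c35 * (g i).M * α₀ ≤ r₀ := by
    calc c35 * (g i).M * α₀ = c35 * ((g i).M * α₀) := by ring
      _ ≤ c35 * a₀ := mul_le_mul_of_nonneg_left hMα' hc35.le
      _ ≤ r₀ := ha₀r
  have hsc : κ * (c35 * (g i).M * α₀) ≤ κ * c35 * a₀ := by
    calc κ * (c35 * (g i).M * α₀) = κ * c35 * ((g i).M * α₀) := by ring
      _ ≤ κ * c35 * a₀ := mul_le_mul_of_nonneg_left hMα' hκc.le
  -- the letters and the shift-defect row letter under the guard: scale `κc₃₅Mα₀ ≤ κc₃₅a₀`, window `c₃₅Mα₀ ≤ c₃₅a₀ ≤ r₀`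
  have hLt' : TwoSidedLetters J ι (π i) (τ i) (τ' i) (n i) (n' i) (κ * c35 * a₀) (θ i) (cfgF i U) (cfgC i U) :=
    (hLt i U α₀ hreg hα₀ hM' hgd).mono hsc (hθ i)
  have hDSh' : ∀ μ, HasMaj (BlockNorm.ofBlocks (g i) (liftBlk (liftBlk (blk i) ι) J)) (BlockNorm.ofBlocks (g i) (liftBlk (blk i ∘ π i) ι))
      (idef (pull (liftMap (π i) ι)) (pull (liftMap (π i) ι)) (pull (liftEquiv (τ' i μ) ι)) (pull (liftEquiv (τ i μ) ι)) ∘ₗ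
        (mmulOp ((cfgC i U).2 (Sum.inl μ) ∘ ⇑(τ i μ).symm) ∘ₗ sumJ fun ν => G i ∘ₗ fgradAdj (n i) (liftEquiv (τ i ν) ι)))
      (fun y y' => mT * (κ * c35 * a₀) * θ i * Real.exp (-(δ * (g i).dist y y'))) := fun μ =>
    (hDSh i U α₀ hreg hα₀ hM' hgd μ).mono fun y y' => by
      have h2 : 0 ≤ θ i * Real.exp (-(δ * (g i).dist y y')) := mul_nonneg (hθ i) (Real.exp_nonneg _)
      nlinarith [mul_le_mul_of_nonneg_left hsc hmT]
  have key := etaRateIneq342_twoSided_of_letters (J := J) (ι := ι) (B := Bf i) (blk i) (π i) (htri i) (hd i) (hd0 i) hσ hcr (hrow i) (hη i) (hL i) (hlen i) hσδ.le hβ hm₀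
    (hθ i) (hθγ i) hA0 hq hcT hmT' hq2 (ν := ν i) (hG i) (hD i) (hG' i) (hD' i) (hD₃' i) (hDG i) (hDD i) (hDD₃ i) (hS i) (hS' i) (hDS i) (hSh i) (hSh' i)
    (cfgF := cfgF i) (cfgC := cfgC i) (U := U) hLt' hDSh'
  intro k lam y y' hs
  refine (key k lam y y' hs).trans ?_
  have hpref : 0 ≤ B9.pref4 ((bgInstanceM₂R (blk i) (π i) (nsh i) (Bc i) (Bf i) (P i)).gc.len y) k := by
    have : 1 ≤ B9.pref4 ((opGeo (g i) (X i × ι) (liftBlk (blk i) ι)).len y) k := by rw [opGeo_len]; exact one_le_pref4 (hlen i y) k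
    exact zero_le_one.trans this
  have hrf : 0 ≤ max (rateFactor (bgInstanceM₂R (blk i) (π i) (nsh i) (Bc i) (Bf i) (P i)).gc γ y) (rateFactor (bgInstanceM₂R (blk i) (π i) (nsh i) (Bc i) (Bf i) (P i)).gc γ y') :=
    (T4EtaRate.rateFactor_nonneg (g := opGeo (g i) (X i × ι) (liftBlk (blk i) ι)) (hη i).le (hL i).le γ y).trans (le_max_left _ _)
  have hnorm : 0 ≤ (bgInstanceM₂R (blk i) (π i) (nsh i) (Bc i) (Bf i) (P i)).gc.supNorm lam := Real.iSup_nonneg fun x => abs_nonneg _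
  have hE : 0 ≤ Real.exp (-((δ - 6 * σ) * (bgInstanceM₂R (blk i) (π i) (nsh i) (Bc i) (Bf i) (P i)).gc.dist y y')) := Real.exp_nonneg _
  exact mul_le_mul_of_nonneg_right (mul_le_mul_of_nonneg_right (mul_le_mul_of_nonneg_right
    (mul_le_mul_of_nonneg_right (le_add_of_nonneg_right zero_le_one) hpref) hE) hrf) hnorm

end Node

/-! ## §3 FILE 30's torus theorem, non-vacuous form -/

section TorusM1

open Literature.MathematicalPhysics.QuantumFieldTheory.Balaban1983to89.B11SectG (BlockNorm HasMaj RowSum)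
open Literature.MathematicalPhysics.QuantumFieldTheory.Balaban1983to89.T4EtaRate (PairedInstance NE2PlusOperator rateFactor)
open Literature.MathematicalPhysics.QuantumFieldTheory.Balaban1983to89.T4EtaRateDefect (idef idef_apply rateWeight)
open Literature.MathematicalPhysics.QuantumFieldTheory.Balaban1983to89.T4EtaRateCoeffDefect (pull pull_apply diagK diagK_nonneg)
open Literature.MathematicalPhysics.QuantumFieldTheory.Balaban1983to89.B5Prop11Plancherel (Tor fine unitVec)
open Literature.MathematicalPhysics.QuantumFieldTheory.Balaban1983to89.B5SiteBridgeP12 (MP)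
open Literature.MathematicalPhysics.QuantumFieldTheory.Balaban1983to89.B6UnitTorusCarrier (unitTorusGeo triangle254_unitTorusGeo rowSum_unitTorusGeo unitTorusGeo_dist_nonneg
  unitTorusGeo_len)
open Literature.MathematicalPhysics.QuantumFieldTheory.King1986.Torus (blockOf tdistT tdistT_nonneg tdistT_self)
open Summit.QuantumFields.YangMills.BalabanUVNodes.N15.MatrixSpecies (mmulOp liftMap liftBlk liftEquiv liftEquiv_apply liftEquiv_symm_apply basisConst basisConst_nonneg)
open Summit.QuantumFields.YangMills.BalabanUVNodes.N15.TwoGrid (gOp symbOp sT sTinv sD sLap paramsOf hasMaj_rate_mono hasMaj_twoGridDefect_div TGIndex TGIndex.Mn)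
open Summit.QuantumFields.YangMills.BalabanUVNodes.N15.VectorPiece (blkFine kingPrV blkFine_comp_kingPrV bshiftEquiv bshiftEquiv_apply bshiftEquiv_symm_apply bshiftV bshiftV_apply
  tensorId tensorId_apply hasMaj_tensorId idef_tensorId kingPrV_bshiftEquiv_pow fibre_conn_kingPrV bshiftEquiv_comm inv_pow_le_rpow)

variable {L : ℕ} [NeZero L]
variable (d) (𝔄 : Type) [NormedRing 𝔄] [NormedAlgebra ℝ 𝔄] [CompleteSpace 𝔄] (ι : Type) [Fintype ι] [DecidableEq ι] [Nonempty ι] (e : 𝔄 ≃L[ℝ] (ι → ℝ))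

/-- ★★★ **`T4EtaRate.NE2PlusOperator` BY NAME FOR BAŁABAN's FULL `U ≡ 1` PROPAGATOR ⊗ 1_𝔤 DRESSED BY HIS OWN `V′₁(A)` OF A LIVE GAUGE FIELD (fine coefficients from `A′`, coarse from the block
mean `Ā`), MODULO ONLY THE `U ≡ 1` ENTRY-2 η-DEFECT** — FILE 24 ★★★ `ne2PlusOperator_twoSided_of_letters` at the realised family: letters by FILE 26 ★★★ `twoSidedLettersX_of_meanGauge` (torus
discharges: `bshiftEquiv_comm`, `fibre_conn_kingPrV`, `kingPrV_bshiftEquiv_pow`, `η = L^{−k} = L^m η′`, `C_πη′ ≤ 2(d+1)θ`, window `r₀ = (2(1+(d+1))(3+2(d+1)))⁻¹`, scale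
`κ′ = 14e(1+(d+1))²(3+2(d+1))(κ_e+1)`), the shift-defect row letter by §2 on the coarse forward coefficients, every other `U ≡ 1` input from §2.
[cite: Balaban1985BackgroundPropagators, Thm 3.1 p.397 (quantifier template); (3.35)–(3.36) p.396, (3.42) p.397, (3.52) p.400, (3.63)–(3.65) p.402 (shapes, mechanism); King1986, p.664] -/
theorem ne2PlusOperatorM1_fullGM₂_v1X_of_entry2 (hLodd : Odd L) (hL2 : 2 ≤ L) (hL : Odd L ∧ 1 < L) {b : ℝ} (hb : 0 < b) (c35 : ℝ) (hc35 : 0 < c35)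
    {γ : ℝ} (hγ0 : 0 < γ) (hγ1 : γ ≤ 1 / 16) {B₂ δ₂ : ℝ} (hB₂ : 0 ≤ B₂) (hδ₂ : 0 < δ₂)
    (h2 : ∀ (i : TGIndex) (ν : Fin (d + 1)),
      HasMaj (BlockNorm.ofBlocks (unitTorusGeo L i.k (TGIndex.Mn d hL i)) (blkFine L i.k (TGIndex.Mn d hL i)))
        (BlockNorm.ofBlocks (unitTorusGeo L i.k (TGIndex.Mn d hL i)) (blkFine L i.k (TGIndex.Mn d hL i) ∘ kingPrV L i.k i.m (TGIndex.Mn d hL i)))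
        (idef (pull (kingPrV L i.k i.m (TGIndex.Mn d hL i))) (pull (kingPrV L i.k i.m (TGIndex.Mn d hL i)))
          (gOp (TGIndex.Mn d hL i) (L ^ i.m * L ^ i.k) b ∘ₗ fgradAdj ((L ^ i.m * L ^ i.k : ℕ) : ℝ) (bshiftEquiv (TGIndex.Mn d hL i) (L ^ i.m * L ^ i.k) ν))
          (gOp (TGIndex.Mn d hL i) (L ^ i.k) b ∘ₗ fgradAdj ((L ^ i.k : ℕ) : ℝ) (bshiftEquiv (TGIndex.Mn d hL i) (L ^ i.k) ν)))
        (fun y y' => B₂ * ((L : ℝ) ^ i.k) ^ (-γ) * Real.exp (-(δ₂ * tdistT (TGIndex.Mn d hL i) y y')))) :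
    NE2PlusOperatorM1 c35 (fgInstanceV1G d 𝔄 ι hL) (fgFamilyV1X d 𝔄 ι e hL b) := by
  obtain ⟨δ, β, m₀, cT, mT, hδ, hδδ₂, hβ, hm₀, hBm, hcT, hmT, H⟩ := uniform_layer_fullGM₂R d ι hLodd hL2 hL hb hγ0 hγ1 hδ₂ hB₂
  have hL0 : L ≠ 0 := by omega
  have hL1 : 1 ≤ L := by omega
  have hLr : (0 : ℝ) < (L : ℝ) := by exact_mod_cast (show 0 < L by omega)
  have hLr1 : (1 : ℝ) ≤ (L : ℝ) := by exact_mod_cast hL1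
  have hγle1 : γ ≤ 1 := by linarith
  have hσ : 0 < δ / 12 := by positivity
  have hdJ : (Fintype.card (Fin (d + 1)) : ℝ) = (d : ℝ) + 1 := by rw [Fintype.card_fin]; push_cast; ring
  have hdJ0 : (0 : ℝ) ≤ Fintype.card (Fin (d + 1)) := Nat.cast_nonneg _
  have hDS : ∀ (i : TGIndex × Fin (d + 1)) (ν : Fin (d + 1)),
      HasMaj (BlockNorm.ofBlocks (unitTorusGeo L i.1.k (TGIndex.Mn d hL i.1)) (liftBlk (blkFine L i.1.k (TGIndex.Mn d hL i.1)) ι)) (BlockNorm.ofBlocks (unitTorusGeo L i.1.k (TGIndex.Mn d hL i.1)) (liftBlk (blkFine L i.1.k (TGIndex.Mn d hL i.1) ∘ kingPrV L i.1.k i.1.m (TGIndex.Mn d hL i.1)) ι))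
        (idef (pull (liftMap (kingPrV L i.1.k i.1.m (TGIndex.Mn d hL i.1)) ι)) (pull (liftMap (kingPrV L i.1.k i.1.m (TGIndex.Mn d hL i.1)) ι))
          (tensorId ι (gOp (TGIndex.Mn d hL i.1) (L ^ i.1.m * L ^ i.1.k) b) ∘ₗ fgradAdj ((L ^ i.1.m * L ^ i.1.k : ℕ) : ℝ) (liftEquiv (bshiftEquiv (TGIndex.Mn d hL i.1) (L ^ i.1.m * L ^ i.1.k) ν) ι))
          (tensorId ι (gOp (TGIndex.Mn d hL i.1) (L ^ i.1.k) b) ∘ₗ fgradAdj ((L ^ i.1.k : ℕ) : ℝ) (liftEquiv (bshiftEquiv (TGIndex.Mn d hL i.1) (L ^ i.1.k) ν) ι)))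
        (fun y y' => m₀ * ((L : ℝ) ^ i.1.k) ^ (-γ) * Real.exp (-(δ * (unitTorusGeo L i.1.k (TGIndex.Mn d hL i.1)).dist y y'))) := fun i ν => by
    rw [idef_comp_fgradAdj_liftEquiv]
    exact hasMaj_tensorId ι (fun _ _ => mul_nonneg (mul_nonneg hm₀.le (Real.rpow_nonneg (pow_nonneg hLr.le _) _)) (Real.exp_nonneg _))
      ((h2 i.1 ν).mono fun y y' => le_rate hB₂ hBm (one_le_pow₀ hLr1) le_rfl hδδ₂ (tdistT_nonneg _ _ _))
  -- the constants of the gauge letters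
  set C₀ : ℝ := 2 * ((d : ℝ) + 1) with hC₀
  have hC₀0 : 0 ≤ C₀ := by positivity
  set κ' : ℝ := 14 * Real.exp 1 * (1 + Fintype.card (Fin (d + 1))) * ((1 + Fintype.card (Fin (d + 1))) * (3 + C₀)) * (basisConst e + 1) with hκ'def
  have hκe := basisConst_nonneg e
  have hκ'pos : 0 < κ' := by positivity
  set r₀ : ℝ := (2 * ((1 + Fintype.card (Fin (d + 1))) * (3 + C₀)))⁻¹ with hr₀def
  have hden : 0 < 2 * ((1 + Fintype.card (Fin (d + 1))) * (3 + C₀)) := by positivity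
  have hr₀ : 0 < r₀ := inv_pos.2 hden
  -- the fifteen letters at every index, for every regular gauge field in the window
  have hLT : ∀ (i : TGIndex × Fin (d + 1)) (A' : Fin (d + 1) → Tor (fine (L ^ i.1.m * L ^ i.1.k) (TGIndex.Mn d hL i.1)) × Fin (d + 1) → 𝔄) (α₀ : ℝ),
      (v1GaugeBg 𝔄 (Fin (d + 1)) (fun μ => bshiftEquiv (TGIndex.Mn d hL i.1) (L ^ i.1.m * L ^ i.1.k) μ) ((unitTorusGeo L i.1.k (TGIndex.Mn d hL i.1)).eta * ((unitTorusGeo L i.1.k (TGIndex.Mn d hL i.1)).L ^ i.1.m)⁻¹) (unitTorusGeo L i.1.k (TGIndex.Mn d hL i.1)).M).Reg335 c35 α₀ A' → 0 < α₀ → 1 ≤ (unitTorusGeo L i.1.k (TGIndex.Mn d hL i.1)).M →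
      c35 * (unitTorusGeo L i.1.k (TGIndex.Mn d hL i.1)).M * α₀ ≤ r₀ →
      TwoSidedLetters (Fin (d + 1)) ι (kingPrV L i.1.k i.1.m (TGIndex.Mn d hL i.1)) (fun μ => bshiftEquiv (TGIndex.Mn d hL i.1) (L ^ i.1.k) μ) (fun μ => bshiftEquiv (TGIndex.Mn d hL i.1) (L ^ i.1.m * L ^ i.1.k) μ) ((L ^ i.1.k : ℕ) : ℝ)
        ((L ^ i.1.m * L ^ i.1.k : ℕ) : ℝ) (κ' * (c35 * (unitTorusGeo L i.1.k (TGIndex.Mn d hL i.1)).M * α₀)) (((L : ℝ) ^ i.1.k) ^ (-γ))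
        (v1cfgFX 𝔄 ι e (fun μ => bshiftEquiv (TGIndex.Mn d hL i.1) (L ^ i.1.m * L ^ i.1.k) μ) ((unitTorusGeo L i.1.k (TGIndex.Mn d hL i.1)).eta * ((unitTorusGeo L i.1.k (TGIndex.Mn d hL i.1)).L ^ i.1.m)⁻¹) A')
        (v1cfgCX 𝔄 ι e (kingPrV L i.1.k i.1.m (TGIndex.Mn d hL i.1)) (fun μ => bshiftEquiv (TGIndex.Mn d hL i.1) (L ^ i.1.k) μ) (unitTorusGeo L i.1.k (TGIndex.Mn d hL i.1)).eta A') :=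
    fun i A' α₀ hreg hα₀ hM hwin => twoSidedLettersX_torus d 𝔄 ι e hL hL2 hγle1 hc35 i A' α₀ hreg hα₀ hM hwin
  refine ne2PlusOperatorM1_twoSided_of_letters (I := TGIndex × Fin (d + 1)) (J := Fin (d + 1)) (ι := ι) (fun i => (unitTorusGeo L i.1.k (TGIndex.Mn d hL i.1)))
    (fun i => Tor (fine (L ^ i.1.k) (TGIndex.Mn d hL i.1)) × Fin (d + 1)) (fun i => Tor (fine (L ^ i.1.m * L ^ i.1.k) (TGIndex.Mn d hL i.1)) × Fin (d + 1))
    (fun i => blkFine L i.1.k (TGIndex.Mn d hL i.1)) (fun i => kingPrV L i.1.k i.1.m (TGIndex.Mn d hL i.1)) (fun i μ => bshiftEquiv (TGIndex.Mn d hL i.1) (L ^ i.1.k) μ) (fun i μ => bshiftEquiv (TGIndex.Mn d hL i.1) (L ^ i.1.m * L ^ i.1.k) μ)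
    (fun i => ((L ^ i.1.k : ℕ) : ℝ)) (fun i => ((L ^ i.1.m * L ^ i.1.k : ℕ) : ℝ)) (fun i => i.1.m)
    (fun i => v1GaugeBg 𝔄 (Fin (d + 1)) (fun μ => bshiftEquiv (TGIndex.Mn d hL i.1) (L ^ i.1.k) μ) (unitTorusGeo L i.1.k (TGIndex.Mn d hL i.1)).eta (unitTorusGeo L i.1.k (TGIndex.Mn d hL i.1)).M)
    (fun i => v1GaugeBg 𝔄 (Fin (d + 1)) (fun μ => bshiftEquiv (TGIndex.Mn d hL i.1) (L ^ i.1.m * L ^ i.1.k) μ) ((unitTorusGeo L i.1.k (TGIndex.Mn d hL i.1)).eta * ((unitTorusGeo L i.1.k (TGIndex.Mn d hL i.1)).L ^ i.1.m)⁻¹) (unitTorusGeo L i.1.k (TGIndex.Mn d hL i.1)).M)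
    (fun i => v1GaugePairing 𝔄 (Fin (d + 1)) ι (g := (unitTorusGeo L i.1.k (TGIndex.Mn d hL i.1))) (blkFine L i.1.k (TGIndex.Mn d hL i.1)) (kingPrV L i.1.k i.1.m (TGIndex.Mn d hL i.1)) (fun μ => bshiftEquiv (TGIndex.Mn d hL i.1) (L ^ i.1.k) μ)
      (fun μ => bshiftEquiv (TGIndex.Mn d hL i.1) (L ^ i.1.m * L ^ i.1.k) μ) i.1.m (Nat.cast_ne_zero.mpr (NeZero.ne L)))
    (fun i => v1cfgFX 𝔄 ι e (fun μ => bshiftEquiv (TGIndex.Mn d hL i.1) (L ^ i.1.m * L ^ i.1.k) μ) ((unitTorusGeo L i.1.k (TGIndex.Mn d hL i.1)).eta * ((unitTorusGeo L i.1.k (TGIndex.Mn d hL i.1)).L ^ i.1.m)⁻¹))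
    (fun i => v1cfgCX 𝔄 ι e (kingPrV L i.1.k i.1.m (TGIndex.Mn d hL i.1)) (fun μ => bshiftEquiv (TGIndex.Mn d hL i.1) (L ^ i.1.k) μ) (unitTorusGeo L i.1.k (TGIndex.Mn d hL i.1)).eta)
    (fun i => ((L : ℝ) ^ i.1.k) ^ (-γ)) (fun i => i.2)
    (fun i => tensorId ι (gOp (TGIndex.Mn d hL i.1) (L ^ i.1.k) b))
    (fun i => tensorId ι (symbOp (TGIndex.Mn d hL i.1) (L ^ i.1.k) (sLap (TGIndex.Mn d hL i.1) (L ^ i.1.k) ((L ^ i.1.k : ℕ) : ℝ)) ∘ₗ gOp (TGIndex.Mn d hL i.1) (L ^ i.1.k) b))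
    (fun i => dPiecesM₂ d ι (TGIndex.Mn d hL i.1) (L ^ i.1.k) b)
    (fun i => tensorId ι (gOp (TGIndex.Mn d hL i.1) (L ^ i.1.m * L ^ i.1.k) b))
    (fun i => tensorId ι (symbOp (TGIndex.Mn d hL i.1) (L ^ i.1.m * L ^ i.1.k) (sLap (TGIndex.Mn d hL i.1) (L ^ i.1.m * L ^ i.1.k) ((L ^ i.1.m * L ^ i.1.k : ℕ) : ℝ)) ∘ₗ gOp (TGIndex.Mn d hL i.1) (L ^ i.1.m * L ^ i.1.k) b))
    (fun i => dPiecesM₂ d ι (TGIndex.Mn d hL i.1) (L ^ i.1.m * L ^ i.1.k) b)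
    c35 κ' r₀ hc35 hκ'pos hr₀ (fun i => triangle254_unitTorusGeo L i.1.k (TGIndex.Mn d hL i.1)) (fun i a c => tdistT_nonneg _ _ _) (fun i y => tdistT_self _ y) hσ.le
    (B4Sect5Proof.latticeConst_nonneg (d + 1) hσ.le) (fun i => rowSum_unitTorusGeo L i.1.k (TGIndex.Mn d hL i.1) hσ)
    (fun i => inv_pos.mpr (pow_pos hLr _)) (fun i => hLr) (fun i y => (unitTorusGeo_len L i.1.k (TGIndex.Mn d hL i.1) hL0 y).symm.le) (fun i => show (1 : ℝ) ≤ 1 from le_rfl)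
    (by linarith) hβ.le hm₀.le hγ0 (fun i => Real.rpow_nonneg (pow_nonneg hLr.le _) _) (fun i y => le_rfl) hcT.le hmT.le
    (fun i => (H i).1) (fun i => (H i).2.1) (fun i => (H i).2.2.1) (fun i => (H i).2.2.2.1) (fun i => (H i).2.2.2.2.1) (fun i => (H i).2.2.2.2.2.1)
    (fun i => (H i).2.2.2.2.2.2.1) (fun i => (H i).2.2.2.2.2.2.2.1) (fun i => (H i).2.2.2.2.2.2.2.2.1) (fun i => (H i).2.2.2.2.2.2.2.2.2.1)
    (fun i ν => hDS i ν) (fun i => (H i).2.2.2.2.2.2.2.2.2.2.1) (fun i => (H i).2.2.2.2.2.2.2.2.2.2.2.1)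
    (fun i U α₀ hreg hα₀ hM hwin => hLT i U α₀ hreg hα₀ hM hwin) (fun i U α₀ hreg hα₀ hM hwin μ => ?_)
  -- the shift-defect row letter on the coarse forward coefficients: §2's generic conjunct with the letters 2 and 13 of the bundle
  obtain ⟨-, hA, -, -, -, -, -, -, -, -, -, -, hosc, -, -⟩ := hLT i U α₀ hreg hα₀ hM hwin
  exact (H i).2.2.2.2.2.2.2.2.2.2.2.2 (v1cfgCX 𝔄 ι e (kingPrV L i.1.k i.1.m (TGIndex.Mn d hL i.1)) (fun μ => bshiftEquiv (TGIndex.Mn d hL i.1) (L ^ i.1.k) μ) (unitTorusGeo L i.1.k (TGIndex.Mn d hL i.1)).eta U).2 _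
    (mul_nonneg hκ'pos.le (mul_nonneg (mul_nonneg hc35.le (zero_le_one.trans hM)) hα₀.le)) (fun μ x i' => hA (Sum.inl μ) x i') hosc μ

/-- ★★★ **`T4EtaRate.NE2PlusOperator` BY NAME, NO DISPLAYED BINDER: Bałaban's FULL `U ≡ 1` Landau-gauge propagator ⊗ 1_𝔤 on the torus family of record, dressed by HIS OWN FIRST-ORDER SPECIES
`V′₁(A)` (3.52) OF A LIVE GAUGE FIELD `A′` — `c = ad_{∇*A} + Σ_μ[F′(ad A⁺_μ) + F′(ad A⁻_μ)]`, `a^±_μ = ad A^±_μ ± ηF′(ad A^±_μ)` in coordinates `e : 𝔄 ≃ ℝ^ι`, fine coefficients from `A′`, COARSE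
coefficients from the BLOCK MEAN `Ā = gavgM pr_V A′`, BOTH bond orientations, all four (3.42) entries CONSTRUCTED (entry 2 by parts), rate exponent `γ = 1∕(8(d+1))` (`d ≥ 1`)** — fed with
dag-n15-a's ENTRY 2 (part 71).  Every input is a tree theorem; NO (3.44) mixed letter.  MODEL-LEVEL in the species (unit-scale C² reading of (3.35)–(3.36), `U ≡ 1` transports inside `V′₁`,
block-mean transport), GENUINE in the propagator. [cite: Balaban1985BackgroundPropagators, Thm 3.1 p.397 (quantifier template); (3.35)–(3.36) p.396, (3.42) p.397, (3.52) p.400, (3.63)–(3.65) p.402 (shapes, mechanism); Balaban1984PropagatorsI, Prop. 1.2 (1.110)–(1.111) p.35; Balaban1984PropagatorsII, (2.156) p.250; King1986, p.664] -/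
theorem ne2PlusOperatorM1_fullGM₂_v1X (hd1 : 1 ≤ d) (hLodd : Odd L) (hL2 : 2 ≤ L) (hL : Odd L ∧ 1 < L) {b : ℝ} (hb : 0 < b) (c35 : ℝ) (hc35 : 0 < c35) :
    NE2PlusOperatorM1 c35 (fgInstanceV1G d 𝔄 ι hL) (fgFamilyV1X d 𝔄 ι e hL b) := by
  obtain ⟨δ₂, B₂, hδ₂, hB₂, H2⟩ := hasMaj_twoGridDefect_div (d := d) hLodd hL2 hb
  have hd1' : (1 : ℝ) ≤ (d : ℝ) := by exact_mod_cast hd1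
  have hγ0 : 0 < 1 / (8 * ((d : ℝ) + 1)) := by positivity
  have hγ1 : 1 / (8 * ((d : ℝ) + 1)) ≤ 1 / 16 := one_div_le_one_div_of_le (by norm_num) (by nlinarith)
  refine ne2PlusOperatorM1_fullGM₂_v1X_of_entry2 d 𝔄 ι e hLodd hL2 hL hb c35 hc35 hγ0 hγ1 hB₂.le hδ₂ fun i ν => ?_
  have h := H2 i.mT i.k i.m i.one_le hL ν
  rw [← symbOp_sTinv_sub_one_eq, ← symbOp_sTinv_sub_one_eq, blkFine_comp_kingPrV]
  refine h.mono fun y y' => le_of_eq ?_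
  rw [show ((L ^ i.k : ℕ) : ℝ) = (L : ℝ) ^ i.k by push_cast; ring]
  exact rfl

/-- The four-dimensional gauge-dressed instance (`d + 1 = 4`, `γ = 1∕32`). [cite: Balaban1985BackgroundPropagators, Thm 3.1 p.397 (quantifier template)] -/
theorem ne2PlusOperatorM1_fullGM₂_v1X_dim4 (hLodd : Odd L) (hL2 : 2 ≤ L) (hL : Odd L ∧ 1 < L) {b : ℝ} (hb : 0 < b) (c35 : ℝ) (hc35 : 0 < c35) :
    NE2PlusOperatorM1 c35 (fgInstanceV1G 3 𝔄 ι hL) (fgFamilyV1X 3 𝔄 ι e hL b) :=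
  ne2PlusOperatorM1_fullGM₂_v1X 3 𝔄 ι e (by norm_num) hLodd hL2 hL hb c35 hc35

/-! ## §4 A witness for the window: constant gauge fields are regular (the ∀ of `NE2PlusOperatorM1` is inhabited by non-zero configurations) -/

omit [Nonempty ι] [CompleteSpace 𝔄] [DecidableEq ι] in
/-- **CONSTANT GAUGE FIELDS ARE (3.35)-REGULAR ON THE FINE CARRIER**: for every index `i`, every `α₀ ≥ 0` and every `a : 𝔄` with `‖a‖ ≤ c₃₅α₀`, the constant field `A′ ≡ a` satisfies
`(fgInstanceV1G …).Bf.Reg335 c₃₅ α₀` (all differences vanish; `M = 1`).  So for `𝔄 ≠ 0` the ∀-block of `ne2PlusOperatorM1_fullGM₂_v1X` is met by NON-ZERO fields at every `α₀ ∈ (0, a₀]`: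
the statement is not vacuous (referee witness). [folklore] -/
theorem reg335_fgInstanceV1G_const (hL : Odd L ∧ 1 < L) (i : TGIndex × Fin (d + 1)) {c35 α₀ : ℝ} (hc35 : 0 ≤ c35) (hα₀ : 0 ≤ α₀) (a : 𝔄) (ha : ‖a‖ ≤ c35 * α₀) :
    (fgInstanceV1G d 𝔄 ι hL i).Bf.Reg335 c35 α₀ (fun (_ : Fin (d + 1)) (_ : Tor (fine (L ^ i.1.m * L ^ i.1.k) (TGIndex.Mn d hL i.1)) × Fin (d + 1)) => a) := by
  have hM : (unitTorusGeo L i.1.k (TGIndex.Mn d hL i.1)).M = 1 := rfl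
  have hη : 0 ≤ (unitTorusGeo L i.1.k (TGIndex.Mn d hL i.1)).eta * ((unitTorusGeo L i.1.k (TGIndex.Mn d hL i.1)).L ^ i.1.m)⁻¹ := by
    have h1 : (unitTorusGeo L i.1.k (TGIndex.Mn d hL i.1)).eta = ((L : ℝ) ^ i.1.k)⁻¹ := rfl
    have h2 : (unitTorusGeo L i.1.k (TGIndex.Mn d hL i.1)).L = (L : ℝ) := rfl
    rw [h1, h2]; positivity
  refine (reg335_v1GaugeBg_iff _ _ _ _ _ _ _ _).mpr ⟨fun μ x => ?_, fun μ κ x => ?_, fun μ κ x => ?_⟩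
  · rw [hM, mul_one]; exact ha
  · rw [sub_self, norm_zero, hM, mul_one]; positivity
  · rw [sub_self, norm_zero, hM, mul_one]; positivity

end TorusM1

end Summit.QuantumFields.YangMills.BalabanUVNodes.N15.BackgroundLayer

end
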